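import Literature.Topology.FourManifolds.SpikedLoop
import HarnessLib

/-!
# Core parameters with prescribed blown-up parameter

Topic `Literature/Topology/FourManifolds` (trunk T-4MAN). Fact seat
`provefact-Literature.Topology.FourManifolds.Knot.IsConnectedSum.isIsotopic` (Schubert's theorem),
geometric heart for rail knots. On the closed lower core the blown-up parameter
`αLo = (χ₁ - 1/2)/κ` is continuous and strictly increasing, vanishes at the centre `tcLo` and
exceeds `±7` at the two ends once `7κ ≤ gapLo`; dually `αHi` is strictly decreasing on the upper
core. This file names, for every level `v ∈ [-7, 7]`, the core parameters `b.parLo hκ h7 hv`,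
`b.parHi hκ h7' hv` with `αLo = v`, `αHi = v` (intermediate value theorem) and records the order
bookkeeping (`alphaLo_le_iff`, `alphaLo_lt_iff`, `parLo_lt_parLo`, `parLo_mem_openCore`, …) used by
the deep closing arcs and the hybrid frames, independently of the host hypotheses of
`HostTrack.lean` (which provide the same service for levels in `[0, 7]` only).

Everything is proved; no named facts are introduced.

## References

Standard; all statements `[folklore]`.
-/

open scoped Manifold ContDiff Topology Real
open Function Set Metric Filter

noncomputable section

namespace Literature.Topology.FourManifolds

/-- Local notation: `𝔼 n` is the model Euclidean space `EuclideanSpace ℝ (Fin n)`. -/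
local notation "𝔼 " n:arg => EuclideanSpace ℝ (Fin n)

/-- Local notation: `𝕊 n` is the unit sphere in `EuclideanSpace ℝ (Fin (n + 1))`. -/
local notation "𝕊 " n:arg => (Metric.sphere (0 : EuclideanSpace ℝ (Fin (n + 1))) 1)

namespace BandData

variable {A B K : Knot} {avoid : Set (𝕊 3)} (b : BandData A B K avoid) {κ : ℝ} (hκ : 0 < κ)

/-! ### The blown-up parameters at the ends of the cores -/

/-- At the centre of the lower core `αLo = 0`. [folklore] -/
theorem alphaLo_tcLo (κ : ℝ) : b.alphaLo κ b.tcLo = 0 := by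
  rw [alphaLo, chiLo_tcLo]; simp

/-- At the centre of the upper core `αHi = 0`. [folklore] -/
theorem alphaHi_tcHi (κ : ℝ) : b.alphaHi κ b.tcHi = 0 := by
  rw [alphaHi, chiHi_tcHi]; simp

include hκ

/-- At the right end of the lower core `αLo ≥ 7` (`7κ ≤ gapLo`). [folklore] -/
theorem seven_le_alphaLo_right (h7 : 7 * κ ≤ b.gapLo) : 7 ≤ b.alphaLo κ (b.tcLo + b.epsLo / 8) := by
  rw [alphaLo, le_div_iff₀ hκ]
  have : b.gapLo ≤ b.chiLo (b.tcLo + b.epsLo / 8) - 1 / 2 := min_le_left _ _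
  linarith

/-- At the left end of the lower core `αLo ≤ -7`. [folklore] -/
theorem alphaLo_left_le (h7 : 7 * κ ≤ b.gapLo) : b.alphaLo κ (b.tcLo - b.epsLo / 8) ≤ -7 := by
  rw [alphaLo, div_le_iff₀ hκ]
  have : b.gapLo ≤ 1 / 2 - b.chiLo (b.tcLo - b.epsLo / 8) := min_le_right _ _
  linarith

/-- At the left end of the upper core `αHi ≥ 7` (`7κ ≤ gapHi`). [folklore] -/
theorem seven_le_alphaHi_left (h7 : 7 * κ ≤ b.gapHi) : 7 ≤ b.alphaHi κ (b.tcHi - b.epsHi / 8) := by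
  rw [alphaHi, le_div_iff₀ hκ]
  have : b.gapHi ≤ b.chiHi (b.tcHi - b.epsHi / 8) - 1 / 2 := min_le_left _ _
  linarith

/-- At the right end of the upper core `αHi ≤ -7`. [folklore] -/
theorem alphaHi_right_le (h7 : 7 * κ ≤ b.gapHi) : b.alphaHi κ (b.tcHi + b.epsHi / 8) ≤ -7 := by
  rw [alphaHi, div_le_iff₀ hκ]
  have : b.gapHi ≤ 1 / 2 - b.chiHi (b.tcHi + b.epsHi / 8) := min_le_right _ _
  linarith

/-! ### Lower-core parameters with prescribed level -/

/-- A lower-core parameter with `αLo = v`, `-7 ≤ v ≤ 7`, exists. [folklore] -/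
theorem exists_alphaLo_eq' (h7 : 7 * κ ≤ b.gapLo) {v : ℝ} (hv : v ∈ Icc (-7 : ℝ) 7) :
    ∃ t ∈ Icc (b.tcLo - b.epsLo / 8) (b.tcLo + b.epsLo / 8), b.alphaLo κ t = v := by
  have hε := b.epsLo_bounds.1
  have hcont : ContinuousOn (b.alphaLo κ) (Icc (b.tcLo - b.epsLo / 8) (b.tcLo + b.epsLo / 8)) :=
    (b.contDiff_alphaLo κ).continuous.continuousOn
  have hmem : v ∈ Icc (b.alphaLo κ (b.tcLo - b.epsLo / 8)) (b.alphaLo κ (b.tcLo + b.epsLo / 8)) :=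
    ⟨by linarith [b.alphaLo_left_le hκ h7, hv.1], by linarith [b.seven_le_alphaLo_right hκ h7, hv.2]⟩
  exact intermediate_value_Icc (by linarith) hcont hmem

/-- **The lower-core parameter with `αLo = v`** (chosen). [folklore] -/
def parLo (h7 : 7 * κ ≤ b.gapLo) {v : ℝ} (hv : v ∈ Icc (-7 : ℝ) 7) : ℝ := (b.exists_alphaLo_eq' hκ h7 hv).choose

/-- The defining property of `parLo`. [folklore] -/
theorem parLo_spec (h7 : 7 * κ ≤ b.gapLo) {v : ℝ} (hv : v ∈ Icc (-7 : ℝ) 7) :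
    b.parLo hκ h7 hv ∈ Icc (b.tcLo - b.epsLo / 8) (b.tcLo + b.epsLo / 8) ∧ b.alphaLo κ (b.parLo hκ h7 hv) = v :=
  (b.exists_alphaLo_eq' hκ h7 hv).choose_spec

/-- `parLo` lies in the closed lower core. [folklore] -/
theorem parLo_mem_core (h7 : 7 * κ ≤ b.gapLo) {v : ℝ} (hv : v ∈ Icc (-7 : ℝ) 7) :
    b.parLo hκ h7 hv ∈ Icc (b.tcLo - b.epsLo / 8) (b.tcLo + b.epsLo / 8) := (b.parLo_spec hκ h7 hv).1

/-- The level of `parLo`. [folklore] -/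
@[simp] theorem alphaLo_parLo (h7 : 7 * κ ≤ b.gapLo) {v : ℝ} (hv : v ∈ Icc (-7 : ℝ) 7) :
    b.alphaLo κ (b.parLo hκ h7 hv) = v := (b.parLo_spec hκ h7 hv).2

/-- `parLo` lies in the open lower core when `|v| < 7`. [folklore] -/
theorem parLo_mem_openCore (h7 : 7 * κ ≤ b.gapLo) {v : ℝ} (hv : v ∈ Icc (-7 : ℝ) 7) (hv' : v ∈ Ioo (-7 : ℝ) 7) :
    b.parLo hκ h7 hv ∈ Ioo (b.tcLo - b.epsLo / 8) (b.tcLo + b.epsLo / 8) := by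
  refine b.mem_coreLo_of_alphaLo hκ (M := 7) (by linarith) ?_
  rw [b.alphaLo_parLo hκ h7 hv]; exact abs_lt.2 ⟨hv'.1, hv'.2⟩

/-- Comparison on the lower core: `αLo s ≤ v ↔ s ≤ parLo v`. [folklore] -/
theorem alphaLo_le_iff' (h7 : 7 * κ ≤ b.gapLo) {v : ℝ} (hv : v ∈ Icc (-7 : ℝ) 7) {s : ℝ}
    (hs : s ∈ Icc (b.tcLo - b.epsLo / 8) (b.tcLo + b.epsLo / 8)) : b.alphaLo κ s ≤ v ↔ s ≤ b.parLo hκ h7 hv := by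
  have key := (b.strictMonoOn_alphaLo (κ := κ) hκ).le_iff_le hs (b.parLo_mem_core hκ h7 hv)
  rwa [b.alphaLo_parLo hκ h7 hv] at key

/-- Comparison on the lower core: `v ≤ αLo s ↔ parLo v ≤ s`. [folklore] -/
theorem le_alphaLo_iff' (h7 : 7 * κ ≤ b.gapLo) {v : ℝ} (hv : v ∈ Icc (-7 : ℝ) 7) {s : ℝ}
    (hs : s ∈ Icc (b.tcLo - b.epsLo / 8) (b.tcLo + b.epsLo / 8)) : v ≤ b.alphaLo κ s ↔ b.parLo hκ h7 hv ≤ s := by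
  have key := (b.strictMonoOn_alphaLo (κ := κ) hκ).le_iff_le (b.parLo_mem_core hκ h7 hv) hs
  rwa [b.alphaLo_parLo hκ h7 hv] at key

/-- Comparison on the lower core, strict. [folklore] -/
theorem alphaLo_lt_iff' (h7 : 7 * κ ≤ b.gapLo) {v : ℝ} (hv : v ∈ Icc (-7 : ℝ) 7) {s : ℝ}
    (hs : s ∈ Icc (b.tcLo - b.epsLo / 8) (b.tcLo + b.epsLo / 8)) : b.alphaLo κ s < v ↔ s < b.parLo hκ h7 hv := by
  have key := (b.strictMonoOn_alphaLo (κ := κ) hκ).lt_iff_lt hs (b.parLo_mem_core hκ h7 hv)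
  rwa [b.alphaLo_parLo hκ h7 hv] at key

/-- Comparison on the lower core, strict. [folklore] -/
theorem lt_alphaLo_iff' (h7 : 7 * κ ≤ b.gapLo) {v : ℝ} (hv : v ∈ Icc (-7 : ℝ) 7) {s : ℝ}
    (hs : s ∈ Icc (b.tcLo - b.epsLo / 8) (b.tcLo + b.epsLo / 8)) : v < b.alphaLo κ s ↔ b.parLo hκ h7 hv < s := by
  have key := (b.strictMonoOn_alphaLo (κ := κ) hκ).lt_iff_lt (b.parLo_mem_core hκ h7 hv) hs
  rwa [b.alphaLo_parLo hκ h7 hv] at key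

/-- **`parLo` is strictly increasing in the level.** [folklore] -/
theorem parLo_lt_parLo (h7 : 7 * κ ≤ b.gapLo) {v w : ℝ} (hv : v ∈ Icc (-7 : ℝ) 7) (hw : w ∈ Icc (-7 : ℝ) 7) (hvw : v < w) :
    b.parLo hκ h7 hv < b.parLo hκ h7 hw := by
  rw [← b.alphaLo_lt_iff' hκ h7 hw (b.parLo_mem_core hκ h7 hv), b.alphaLo_parLo hκ h7 hv]; exact hvw

/-- `parLo` is monotone in the level. [folklore] -/
theorem parLo_le_parLo (h7 : 7 * κ ≤ b.gapLo) {v w : ℝ} (hv : v ∈ Icc (-7 : ℝ) 7) (hw : w ∈ Icc (-7 : ℝ) 7) (hvw : v ≤ w) :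
    b.parLo hκ h7 hv ≤ b.parLo hκ h7 hw := by
  rw [← b.alphaLo_le_iff' hκ h7 hw (b.parLo_mem_core hκ h7 hv), b.alphaLo_parLo hκ h7 hv]; exact hvw

/-- `parLo` at the level `0` is the centre of the core. [folklore] -/
theorem parLo_zero (h7 : 7 * κ ≤ b.gapLo) : b.parLo hκ h7 (v := 0) ⟨by norm_num, by norm_num⟩ = b.tcLo := by
  have hε := b.epsLo_bounds.1
  have htc : b.tcLo ∈ Icc (b.tcLo - b.epsLo / 8) (b.tcLo + b.epsLo / 8) := ⟨by linarith, by linarith⟩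
  refine (b.strictMonoOn_alphaLo (κ := κ) hκ).injOn (b.parLo_mem_core hκ h7 _) htc ?_
  rw [b.alphaLo_parLo hκ h7, b.alphaLo_tcLo]

/-! ### Upper-core parameters with prescribed level -/

/-- An upper-core parameter with `αHi = v`, `-7 ≤ v ≤ 7`, exists. [folklore] -/
theorem exists_alphaHi_eq' (h7 : 7 * κ ≤ b.gapHi) {v : ℝ} (hv : v ∈ Icc (-7 : ℝ) 7) :
    ∃ t ∈ Icc (b.tcHi - b.epsHi / 8) (b.tcHi + b.epsHi / 8), b.alphaHi κ t = v := by
  have hε := b.epsHi_bounds.1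
  -- `αHi` is decreasing: apply the intermediate value theorem to `-αHi`
  have hcont : ContinuousOn (fun t ↦ -b.alphaHi κ t) (Icc (b.tcHi - b.epsHi / 8) (b.tcHi + b.epsHi / 8)) :=
    (b.contDiff_alphaHi κ).continuous.neg.continuousOn
  have hmem : -v ∈ Icc (-b.alphaHi κ (b.tcHi - b.epsHi / 8)) (-b.alphaHi κ (b.tcHi + b.epsHi / 8)) :=
    ⟨by linarith [b.seven_le_alphaHi_left hκ h7, hv.2], by linarith [b.alphaHi_right_le hκ h7, hv.1]⟩
  obtain ⟨t, ht, he⟩ := intermediate_value_Icc (by linarith) hcont hmem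
  exact ⟨t, ht, by simpa using he⟩

/-- **The upper-core parameter with `αHi = v`** (chosen). [folklore] -/
def parHi (h7 : 7 * κ ≤ b.gapHi) {v : ℝ} (hv : v ∈ Icc (-7 : ℝ) 7) : ℝ := (b.exists_alphaHi_eq' hκ h7 hv).choose

/-- The defining property of `parHi`. [folklore] -/
theorem parHi_spec (h7 : 7 * κ ≤ b.gapHi) {v : ℝ} (hv : v ∈ Icc (-7 : ℝ) 7) :
    b.parHi hκ h7 hv ∈ Icc (b.tcHi - b.epsHi / 8) (b.tcHi + b.epsHi / 8) ∧ b.alphaHi κ (b.parHi hκ h7 hv) = v :=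
  (b.exists_alphaHi_eq' hκ h7 hv).choose_spec

/-- `parHi` lies in the closed upper core. [folklore] -/
theorem parHi_mem_core (h7 : 7 * κ ≤ b.gapHi) {v : ℝ} (hv : v ∈ Icc (-7 : ℝ) 7) :
    b.parHi hκ h7 hv ∈ Icc (b.tcHi - b.epsHi / 8) (b.tcHi + b.epsHi / 8) := (b.parHi_spec hκ h7 hv).1

/-- The level of `parHi`. [folklore] -/
@[simp] theorem alphaHi_parHi (h7 : 7 * κ ≤ b.gapHi) {v : ℝ} (hv : v ∈ Icc (-7 : ℝ) 7) :
    b.alphaHi κ (b.parHi hκ h7 hv) = v := (b.parHi_spec hκ h7 hv).2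

/-- `parHi` lies in the open upper core when `|v| < 7`. [folklore] -/
theorem parHi_mem_openCore (h7 : 7 * κ ≤ b.gapHi) {v : ℝ} (hv : v ∈ Icc (-7 : ℝ) 7) (hv' : v ∈ Ioo (-7 : ℝ) 7) :
    b.parHi hκ h7 hv ∈ Ioo (b.tcHi - b.epsHi / 8) (b.tcHi + b.epsHi / 8) := by
  refine b.mem_coreHi_of_alphaHi hκ (M := 7) (by linarith) ?_
  rw [b.alphaHi_parHi hκ h7 hv]; exact abs_lt.2 ⟨hv'.1, hv'.2⟩

/-- Comparison on the upper core: `αHi s ≤ v ↔ parHi v ≤ s`. [folklore] -/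
theorem alphaHi_le_iff' (h7 : 7 * κ ≤ b.gapHi) {v : ℝ} (hv : v ∈ Icc (-7 : ℝ) 7) {s : ℝ}
    (hs : s ∈ Icc (b.tcHi - b.epsHi / 8) (b.tcHi + b.epsHi / 8)) : b.alphaHi κ s ≤ v ↔ b.parHi hκ h7 hv ≤ s := by
  have key := StrictAntiOn.le_iff_ge (b.strictAntiOn_alphaHi (κ := κ) hκ) hs (b.parHi_mem_core hκ h7 hv)
  rwa [b.alphaHi_parHi hκ h7 hv] at key

/-- Comparison on the upper core: `v ≤ αHi s ↔ s ≤ parHi v`. [folklore] -/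
theorem le_alphaHi_iff' (h7 : 7 * κ ≤ b.gapHi) {v : ℝ} (hv : v ∈ Icc (-7 : ℝ) 7) {s : ℝ}
    (hs : s ∈ Icc (b.tcHi - b.epsHi / 8) (b.tcHi + b.epsHi / 8)) : v ≤ b.alphaHi κ s ↔ s ≤ b.parHi hκ h7 hv := by
  have key := StrictAntiOn.le_iff_ge (b.strictAntiOn_alphaHi (κ := κ) hκ) (b.parHi_mem_core hκ h7 hv) hs
  rwa [b.alphaHi_parHi hκ h7 hv] at key

/-- Comparison on the upper core, strict. [folklore] -/
theorem alphaHi_lt_iff' (h7 : 7 * κ ≤ b.gapHi) {v : ℝ} (hv : v ∈ Icc (-7 : ℝ) 7) {s : ℝ}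
    (hs : s ∈ Icc (b.tcHi - b.epsHi / 8) (b.tcHi + b.epsHi / 8)) : b.alphaHi κ s < v ↔ b.parHi hκ h7 hv < s := by
  rw [← not_le, b.le_alphaHi_iff' hκ h7 hv hs, not_le]

/-- Comparison on the upper core, strict. [folklore] -/
theorem lt_alphaHi_iff' (h7 : 7 * κ ≤ b.gapHi) {v : ℝ} (hv : v ∈ Icc (-7 : ℝ) 7) {s : ℝ}
    (hs : s ∈ Icc (b.tcHi - b.epsHi / 8) (b.tcHi + b.epsHi / 8)) : v < b.alphaHi κ s ↔ s < b.parHi hκ h7 hv := by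
  rw [← not_le, b.alphaHi_le_iff' hκ h7 hv hs, not_le]

/-- **`parHi` is strictly decreasing in the level.** [folklore] -/
theorem parHi_lt_parHi (h7 : 7 * κ ≤ b.gapHi) {v w : ℝ} (hv : v ∈ Icc (-7 : ℝ) 7) (hw : w ∈ Icc (-7 : ℝ) 7) (hvw : v < w) :
    b.parHi hκ h7 hw < b.parHi hκ h7 hv := by
  rw [← b.lt_alphaHi_iff' hκ h7 hv (b.parHi_mem_core hκ h7 hw), b.alphaHi_parHi hκ h7 hw]; exact hvw

/-- `parHi` is antitone in the level. [folklore] -/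
theorem parHi_le_parHi (h7 : 7 * κ ≤ b.gapHi) {v w : ℝ} (hv : v ∈ Icc (-7 : ℝ) 7) (hw : w ∈ Icc (-7 : ℝ) 7) (hvw : v ≤ w) :
    b.parHi hκ h7 hw ≤ b.parHi hκ h7 hv := by
  rw [← b.le_alphaHi_iff' hκ h7 hv (b.parHi_mem_core hκ h7 hw), b.alphaHi_parHi hκ h7 hw]; exact hvw

/-- `parHi` at the level `0` is the centre of the core. [folklore] -/
theorem parHi_zero (h7 : 7 * κ ≤ b.gapHi) : b.parHi hκ h7 (v := 0) ⟨by norm_num, by norm_num⟩ = b.tcHi := by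
  have hε := b.epsHi_bounds.1
  have htc : b.tcHi ∈ Icc (b.tcHi - b.epsHi / 8) (b.tcHi + b.epsHi / 8) := ⟨by linarith, by linarith⟩
  refine (b.strictAntiOn_alphaHi (κ := κ) hκ).injOn (b.parHi_mem_core hκ h7 _) htc ?_
  rw [b.alphaHi_parHi hκ h7, b.alphaHi_tcHi]

/-! ### The two cores in the fundamental domain -/

omit hκ in
/-- **The lower core precedes the upper core** and both lie inside the open fundamental domain
`(alo, alo + 1)`. [folklore] -/
theorem core_marks : b.alo < b.tcLo - b.epsLo / 8 ∧ b.tcLo + b.epsLo / 8 < b.tcHi - b.epsHi / 8 ∧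
    b.tcHi + b.epsHi / 8 < b.alo + 1 := by
  obtain ⟨h1, h2, hε⟩ := b.tcLo_window
  obtain ⟨h3, h4, hε'⟩ := b.tcHi_window
  have hm := b.marks_lt
  exact ⟨by linarith, by linarith, by linarith⟩

/-- Every lower-core parameter precedes every upper-core parameter. [folklore] -/
theorem parLo_lt_parHi (h7 : 7 * κ ≤ b.gapLo) (h7' : 7 * κ ≤ b.gapHi) {v w : ℝ} (hv : v ∈ Icc (-7 : ℝ) 7)
    (hw : w ∈ Icc (-7 : ℝ) 7) : b.parLo hκ h7 hv < b.parHi hκ h7' hw := by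
  have h1 := (b.parLo_mem_core hκ h7 hv).2
  have h2 := (b.parHi_mem_core hκ h7' hw).1
  linarith [b.core_marks.2.1]

end BandData

end Literature.Topology.FourManifolds
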